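import Summits.ABC.ABC.Theorems.RibetTakahashiSplitManyPrimeValuationProductBootstrap
import HarnessLib

/-!
# Crux `XiStrongBound` (stmt-ABC-11337), line SplitProof — stub 3: the valuation-product bound

Stub 3 (`stub_valuationProductBound`) of line SplitProof for the crux
`Summit.ABC.ABC.Theses.DefiniteXi.XiStrongBound` (stmt-ABC-11337): the valuation product of an
integer is sub-polynomial, i.e. for every `δ > 0` there is `A` with
`∏_{q ∈ S} v_q(n) ≤ A · n^δ` for every `n ≠ 0` and every finite set `S` of primes.

This is the tree's `ManyPrimeValuationProduct.prod_factorization_le_rpow`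
(`Summits/ABC/ABC/Theorems/RibetTakahashiSplitManyPrimeValuationProductBootstrap.lean`, §1), which
states the bound for `S ⊆ n.primeFactors`; here `S` is an arbitrary finite set of primes, and a prime
`q ∈ S` not dividing `n` has `v_q(n) = 0`, so the product vanishes and the bound is trivial.
No new definitions.
-/

-- `Summit.<Summit>.<Problem>` is the mandated summit-side namespace (CONVENTIONS §2); for the single-conjunct summit `ABC` the two coincide, so the duplicate `ABC.ABC` is deliberate.
set_option linter.dupNamespace false

namespace Summit.ABC.ABC.Theorems

/-- **The valuation product of an integer is sub-polynomial** (arbitrary finite sets of primes):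
for every `δ > 0` there is `A` such that for every `n ≠ 0` and every finite set `S` of primes,
`∏_{q ∈ S} v_q(n) ≤ A · n^δ`.  If `S ⊆ n.primeFactors` this is
`ManyPrimeValuationProduct.prod_factorization_le_rpow`; otherwise some prime `q ∈ S` does not divide
`n`, so `v_q(n) = 0`, the product is `0`, and `0 ≤ A · n^δ` as `A > 0`. [folklore] -/
theorem stub_valuationProductBound :
    ∀ δ : ℝ, 0 < δ → ∃ A : ℝ, ∀ n : ℕ, n ≠ 0 → ∀ S : Finset ℕ, (∀ q ∈ S, q.Prime) →
      ((∏ q ∈ S, n.factorization q : ℕ) : ℝ) ≤ A * (n : ℝ) ^ δ := by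
  intro δ hδ
  obtain ⟨A, hA, h⟩ := ManyPrimeValuationProduct.prod_factorization_le_rpow hδ
  refine ⟨A, fun n hn S hS => ?_⟩
  by_cases hsub : S ⊆ n.primeFactors
  · exact h n hn S hsub
  · -- some prime `q ∈ S` is not a prime factor of `n`, hence `v_q(n) = 0`
    obtain ⟨q, hqS, hq⟩ := Finset.not_subset.mp hsub
    have hq0 : n.factorization q = 0 := by
      rw [← Finsupp.notMem_support_iff, Nat.support_factorization]
      exact hq
    have hprod : (∏ p ∈ S, n.factorization p : ℕ) = 0 :=
      Finset.prod_eq_zero hqS hq0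
    rw [hprod, Nat.cast_zero]
    exact mul_nonneg hA.le (Real.rpow_nonneg (Nat.cast_nonneg n) δ)

end Summit.ABC.ABC.Theorems
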